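import Summits.HodgeConjecture.HodgeConjecture.Theorems.R90S6TwistedShellLatticeDict     -- ★ J2′ `mul_mul_mem_doubleCoset_iff` (brings ★ L1 `R90S6LatticeInvPolarity`: `qsInvolution_inv`, `qsInvolution_zpowDiagGL`,
                                                                                        --   `qsInvolution_mem_glInt`, ★ W7-f `mem_glInt_iff_isIntMatrix`, ★ `UnitaryGroup.coe_qsInvolution_apply`, Mathlib `DoubleCoset`)
import Summits.HodgeConjecture.HodgeConjecture.Theorems.R90S6TwistedPolarityInvolution    -- ★ L2 (the frame map `g ↦ δ·Θ_σ(g)` of `τ_δ`; brings ★ `mul_zpowDiagGL_const_comm`, `zpowDiagGL_add`, `zpowDiagGL_neg`)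
import Mathlib.GroupTheory.GroupAction.Quotient
import HarnessLib

/-!
# R90 · S6 «Ch. 14.1–14.5 stable trace formula» — card (T4-SYM) (row E1.4.4.2.2): THE EXACT SYMMETRIES OF THE TWISTED SHELL COUNT `a ↦ #Shell(δ′, a)`
# (`Theorems/R90S6TwistedShellSymmetries.lean`)

Cell `hodgecm-mathlib`, crux H413 (`stmt-HodgeConjecture-24833`), route of record `HCCMUnconditional`; programme R90-TF, section S6 (base `R90-C14`, dealer R90-C14-plan (g3)),
seat R90-C14-p04 (g3); card **(T4-SYM)** (DEAL 2026-09-05T03:43:55Z, R90 bus l.11996): the five §2 heads of typ2 (g3)'s (T4) SHEET OF RECORD v2.2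
`R90/R90-C14-typ2/g3/S6_T4_TwistedEllipticCount_Targets.v2.58d0b56434f3ab26.lean` :131 :144 :156 :169 :182, statements byte-identical (v2.2 = v2 8dacb7777119425b with the
binder `hvσ` prepended to (T4.3b), census (Q-3b) 03:47:34Z, dealer RULINGS #10 (R36) + typ2 SPEC «=» 03:48:56Z).
Lane `--kind proof --supports stmt-HodgeConjecture-24833 --as helper`; THEOREMS ONLY over ★ `Theorems` ∕ Literature ∕ Mathlib carriers (no definition, no instance, no notation,
no named fact, no kit, no `sorry`).

LETTERS (verbatim ★ J1′ ∕ ★ J2′ ∕ ★ L2-sgn ∕ ★ K7): carrier `GL_N(K)` over a valued field `K` (`Valued K ℤᵐ⁰` + compatible `ValuativeRel K`, uniformizing element `ϖ`), twist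
`Θ_σ = UnitaryGroup.qsInvolution σ` (`g ↦ w⁰ ᵗ(σg)⁻¹ w⁰`), `K̃ = glInt N K = GL_N(𝒪)`, Cartan representative `ϖ^a = zpowDiagGL hϖ.ne_zero a`, and the TWISTED SHELL of a base point
`δ′` at exponent `a`
  `Shell(δ′, a) = {q : GL_N(K) ⧸ K̃ | q.out⁻¹ · δ′ · Θ_σ(q.out) ∈ K̃ · ϖ^a · K̃}`   (counted by `Set.ncard`, both sides of every identity `0` together when infinite).

THE MATHEMATICS ([Kottwitz1986BaseChangeUnits] §1 pp. 239–242, §3; [Rogawski1990] §4.10 (4.10.2) p. 58; [Macdonald1995] Ch. V §2 (2.6)).  Everything is GROUP THEORY on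
`GL_N(K) ⧸ K̃` — no `relPos`, no DVR instance:
* §1 `qsInvolution_mem_glInt_iff` (`Θ_σ x ∈ K̃ ⟺ x ∈ K̃`, `σ` isometric), `mk_out_twistedConj_mem_doubleCoset_iff` (R: the shell test at `(gK̃).out` is the shell test at
  `g` — the predicate `g ↦ g⁻¹δ′Θ_σ(g) ∈ K̃ϖ^aK̃` is right-`K̃`-invariant because `Θ_σ(K̃) ⊆ K̃`, ★ J2′ `mul_mul_mem_doubleCoset_iff`), `qsInvolution_mem_doubleCoset_neg_rev`
  (`Θ_σ(K̃ϖ^aK̃) ⊆ K̃ϖ^{−w₀a}K̃`, ★ L1 `qsInvolution_zpowDiagGL`), `zpowDiagGL_const_mul_mem_doubleCoset_add_iff` (`ϖ^{k·1}x ∈ K̃ϖ^{a+k·1}K̃ ⟺ x ∈ K̃ϖ^aK̃`, centrality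
  ★ `mul_zpowDiagGL_const_comm`), and the two-injection count `ncard_eq_ncard_of_mapsTo_of_injOn`;
* §2 the five heads: **(T4.1) `ncard_twistedShell_twistedConj_eq`** `#Shell(h⁻¹δ′Θ_σ h, a) = #Shell(δ′, a)` (left translation `q ↦ h • q`, Mathlib `MulAction.toPerm`);
  **(T4.2) `ncard_twistedShell_eq_ncard_twistedShell_neg_rev`** `#Shell(δ′, a) = #Shell(δ′, −w₀a)` (the frame map `τ : gK̃ ↦ δ′Θ_σ(g)K̃` of ★ L2 is injective on cosets and
  carries `Shell(δ′, b)` into `Shell(δ′, −w₀b)` for every `b`; used at `b = a` and `b = −w₀a` — two injections, so no `σ ∘ σ = id` is needed); **(T4.3a)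
  `twistedShell_zpowDiagGL_const_mul_eq`** `Shell(ϖ^{k·1}δ′, a + k·1) = Shell(δ′, a)` as sets; **(T4.3b) `ncard_twistedShell_eq_ncard_twistedShell_sub_two`** `#Shell(δ′, a) =
  #Shell(δ′, a − 2·1)` (= (T4.1) at `h = ϖ^{−1·1}`, `Θ_σ(ϖ^{−1·1}) = ϖ^{1·1}`, then (T4.3a) at `k = 2`); **(T4.3c) `ncard_twistedShell_one_one_zero_eq`** (`N = 3`)
  `#Shell(δ′, (1,1,0)) = #Shell(ϖ·δ′, (1,0,0))` (= (T4.2): `−w₀(1,1,0) = (0,−1,−1)`, then (T4.3a) at `k = 1`).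
ON (T4.3b)'s BINDER `hvσ` (census (Q-3b), R90 bus 2026-09-05T03:47:34Z; dealer (R36) + typ2 SPEC «=», sheet re-cut v2.2): sheet v2's :168 carried `hσϖ` only; without `σ`
isometric the `q.out`-tested shell depends on the choice of coset representatives (the move from `ϖ·q.out` to `(ϖ•q).out` is lemma R), so the identity is not derivable for
Mathlib's unspecified `Quotient.out` (model: `K = ℚ(s)(t)` `t`-adic, `σ : s ↦ st`, `N = 1`, a rigged section `n ↦ s^{j(n)}t^n`); v2.2 :169 carries `hvσ` as first binder —
the binder (T4.1) ∕ (T4.2) ∕ (T4.3c) already carry.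
HONEST LABEL: count symmetries for DAG row E1.4.4.2.2, count-neutral until the VALUE targets (T4.7)∕(T4.8) and K8's sums consume them; proves no printed global statement,
discharges no citation; HC_CM is proved only modulo the 7 printed citations (2 remaining named inputs: hLiu418 = stmt-HodgeConjecture-24832, h413 = stmt-HodgeConjecture-24833)
until rung 0 closes.

## References
* [Kottwitz1986BaseChangeUnits] R. E. Kottwitz, *Base change for unit elements of Hecke algebras*, Compositio Math. 60 (1986): §1 pp. 239–242 (the `σ`-twisted cosets `X_L`,
  `gK_L ↦ δσ(g)K_L`, «inv»), §3 (the symmetries of «inv» under the twisted action).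
* [Rogawski1990] J. D. Rogawski, *Automorphic Representations of Unitary Groups in Three Variables*, Ann. of Math. Stud. 123 (1990): §1.9–§1.10 pp. 8–9 (`Θ`, `w⁰`), §3.11–§3.12
  pp. 34–36 (ε-conjugacy), §4.10 (4.10.2) p. 58 (the classes `H¹(F, T)` and the cocycle `ϖ`).
* [Macdonald1995] I. G. Macdonald, *Symmetric Functions and Hall Polynomials*, 2nd ed. (1995): Ch. V §2 (2.6) (`G ∕ K` = lattices, the shells `Kϖ^aK`).
-/

set_option autoImplicit false
-- the mandated namespace repeats the single-problem summit's segment (`HodgeConjecture.HodgeConjecture`)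
set_option linter.dupNamespace false

noncomputable section

open scoped Matrix MatrixGroups Valued WithZero Pointwise
open Literature.NumberTheory.Automorphic Literature.NumberTheory.Automorphic.HermitianLattice Literature.NumberTheory.Automorphic.UnitaryLatticeTree

namespace Summit.HodgeConjecture.HodgeConjecture.R90.S6

/-! ## §1 Tools: `Θ_σ` and `GL_N(𝒪)`, representative-independence of the shell test, the shell under `Θ_σ` and under central shifts, a two-injection count -/

section Tools

variable {K : Type} [Field K] [Valued K ℤᵐ⁰] [ValuativeRel K] [(Valued.v : Valuation K ℤᵐ⁰).Compatible] {σ : K →+* K} {N : ℕ}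
  {ϖ : K} (hϖ : IsUniformizingElement ϖ)

/-- **`Θ_σ x ∈ GL_N(𝒪) ⟺ x ∈ GL_N(𝒪)`** for `σ` valuation-preserving: the entries of `Θ_σ x` are `σ` of entries of `x⁻¹` and those of `(Θ_σ x)⁻¹ = Θ_σ(x⁻¹)` are `σ` of entries of
`x` (★ `coe_qsInvolution_apply`, ★ W7-f `mem_glInt_iff_isIntMatrix`); so the frame map `g ↦ δ·Θ_σ(g)` is injective on `GL_N(K) ⧸ GL_N(𝒪)`. [cite: Kottwitz1986BaseChangeUnits, §1 p. 240]
[cite: Rogawski1990, §1.10 p. 9] -/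
theorem qsInvolution_mem_glInt_iff (hvσ : ∀ a, Valued.v (σ a) = Valued.v a) (x : GL (Fin N) K) :
    UnitaryGroup.qsInvolution σ x ∈ glInt N K ↔ x ∈ glInt N K := by
  refine ⟨fun hx => ?_, qsInvolution_mem_glInt hvσ⟩
  rw [mem_glInt_iff_isIntMatrix] at hx ⊢
  refine ⟨fun i j => ?_, fun i j => ?_⟩
  · have h := hx.2 (Fin.rev j) (Fin.rev i)
    rw [← qsInvolution_inv, UnitaryGroup.coe_qsInvolution_apply, inv_inv, Fin.rev_rev, Fin.rev_rev, hvσ] at h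
    exact h
  · have h := hx.1 (Fin.rev j) (Fin.rev i)
    rw [UnitaryGroup.coe_qsInvolution_apply, Fin.rev_rev, Fin.rev_rev, hvσ] at h
    exact h

/-- **(R) THE SHELL TEST DOES NOT SEE THE REPRESENTATIVE**: for `σ` valuation-preserving, `d ∈ GL_N(K)` and any `g`, the test `y⁻¹·δ·Θ_σ(y) ∈ K̃·d·K̃` at `y = (gK̃).out = g·k`
(`k ∈ K̃`, Mathlib `QuotientGroup.mk_out_eq_mul`) is the test at `y = g`: `(gk)⁻¹δΘ_σ(gk) = k⁻¹·(g⁻¹δΘ_σ g)·Θ_σ(k)` with `k⁻¹, Θ_σ(k) ∈ K̃` (★ L1 `qsInvolution_mem_glInt`, ★ J2′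
`mul_mul_mem_doubleCoset_iff`). [cite: Kottwitz1986BaseChangeUnits, §1 p. 240] -/
theorem mk_out_twistedConj_mem_doubleCoset_iff (hvσ : ∀ a, Valued.v (σ a) = Valued.v a) (δ d g : GL (Fin N) K) :
    ((g : GL (Fin N) K ⧸ glInt N K)).out⁻¹ * δ * UnitaryGroup.qsInvolution σ ((g : GL (Fin N) K ⧸ glInt N K)).out ∈
        (glInt N K : Set (GL (Fin N) K)) * {d} * (glInt N K : Set (GL (Fin N) K)) ↔
      g⁻¹ * δ * UnitaryGroup.qsInvolution σ g ∈ (glInt N K : Set (GL (Fin N) K)) * {d} * (glInt N K : Set (GL (Fin N) K)) := by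
  obtain ⟨k, hk⟩ := QuotientGroup.mk_out_eq_mul (glInt N K) g
  have e : ((g : GL (Fin N) K ⧸ glInt N K)).out⁻¹ * δ * UnitaryGroup.qsInvolution σ ((g : GL (Fin N) K ⧸ glInt N K)).out =
      (k : GL (Fin N) K)⁻¹ * (g⁻¹ * δ * UnitaryGroup.qsInvolution σ g) * UnitaryGroup.qsInvolution σ (k : GL (Fin N) K) := by
    rw [hk, mul_inv_rev, UnitaryGroup.qsInvolution_mul]
    group
  rw [e]
  exact mul_mul_mem_doubleCoset_iff d ((glInt N K).inv_mem k.2) (qsInvolution_mem_glInt hvσ k.2) _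

/-- **`Θ_σ(K̃·ϖ^a·K̃) ⊆ K̃·ϖ^{−w₀a}·K̃`**: `Θ_σ(k₁ϖ^ak₂) = Θ_σ(k₁)·ϖ^{(−a_{rev i})_i}·Θ_σ(k₂)` (★ `qsInvolution_mul`, ★ L1 `qsInvolution_zpowDiagGL` for `σ ϖ = ϖ`, `qsInvolution_mem_glInt`).
[cite: Kottwitz1986BaseChangeUnits, §3] [cite: Macdonald1995, Ch. V §2 (2.6)] -/
theorem qsInvolution_mem_doubleCoset_neg_rev (hvσ : ∀ a, Valued.v (σ a) = Valued.v a) (hσϖ : σ ϖ = ϖ) {a : Fin N → ℤ} {x : GL (Fin N) K}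
    (hx : x ∈ (glInt N K : Set (GL (Fin N) K)) * {zpowDiagGL hϖ.ne_zero a} * (glInt N K : Set (GL (Fin N) K))) :
    UnitaryGroup.qsInvolution σ x ∈
      (glInt N K : Set (GL (Fin N) K)) * {zpowDiagGL hϖ.ne_zero (fun i => - a (Fin.rev i))} * (glInt N K : Set (GL (Fin N) K)) := by
  change x ∈ DoubleCoset.doubleCoset (zpowDiagGL hϖ.ne_zero a) (glInt N K : Set (GL (Fin N) K)) (glInt N K) at hx
  change UnitaryGroup.qsInvolution σ x ∈
    DoubleCoset.doubleCoset (zpowDiagGL hϖ.ne_zero (fun i => - a (Fin.rev i))) (glInt N K : Set (GL (Fin N) K)) (glInt N K)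
  obtain ⟨k₁, hk₁, k₂, hk₂, rfl⟩ := DoubleCoset.mem_doubleCoset.1 hx
  exact DoubleCoset.mem_doubleCoset.2 ⟨UnitaryGroup.qsInvolution σ k₁, qsInvolution_mem_glInt hvσ hk₁, UnitaryGroup.qsInvolution σ k₂, qsInvolution_mem_glInt hvσ hk₂,
    by rw [UnitaryGroup.qsInvolution_mul, UnitaryGroup.qsInvolution_mul, qsInvolution_zpowDiagGL hϖ.ne_zero hσϖ]⟩

/-- **THE FRAME MAP CARRIES `Shell(δ′, a)` INTO `Shell(δ′, −w₀a)`** (frames): `g⁻¹δ′Θ_σ(g) ∈ K̃ϖ^aK̃ ⟹ (δ′Θ_σ g)⁻¹·δ′·Θ_σ(δ′Θ_σ g) = Θ_σ(g⁻¹δ′Θ_σ g) ∈ K̃ϖ^{−w₀a}K̃` — ★ L2's `τ_{δ′} : Λ ↦ δ′Λ^♯`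
reverses type (its `relPos` form is ★ `relPos_twistFrame`; here the shell form, valid for every `a`, sorted or not). [cite: Kottwitz1986BaseChangeUnits, §3] [cite: Macdonald1995, Ch. V §2 (2.6)] -/
theorem twistFrame_twistedConj_mem_doubleCoset_neg_rev (hvσ : ∀ a, Valued.v (σ a) = Valued.v a) (hσϖ : σ ϖ = ϖ) (δ' : GL (Fin N) K) {a : Fin N → ℤ} {g : GL (Fin N) K}
    (hg : g⁻¹ * δ' * UnitaryGroup.qsInvolution σ g ∈ (glInt N K : Set (GL (Fin N) K)) * {zpowDiagGL hϖ.ne_zero a} * (glInt N K : Set (GL (Fin N) K))) :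
    (δ' * UnitaryGroup.qsInvolution σ g)⁻¹ * δ' * UnitaryGroup.qsInvolution σ (δ' * UnitaryGroup.qsInvolution σ g) ∈
      (glInt N K : Set (GL (Fin N) K)) * {zpowDiagGL hϖ.ne_zero (fun i => - a (Fin.rev i))} * (glInt N K : Set (GL (Fin N) K)) := by
  have e : (δ' * UnitaryGroup.qsInvolution σ g)⁻¹ * δ' * UnitaryGroup.qsInvolution σ (δ' * UnitaryGroup.qsInvolution σ g) =
      UnitaryGroup.qsInvolution σ (g⁻¹ * δ' * UnitaryGroup.qsInvolution σ g) := by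
    simp only [UnitaryGroup.qsInvolution_mul, qsInvolution_inv, mul_inv_rev]
    group
  rw [e]
  exact qsInvolution_mem_doubleCoset_neg_rev hϖ hvσ hσϖ hg

omit hϖ in
/-- **THE FRAME MAP IS INJECTIVE ON COSETS**: `q ↦ (δ′·Θ_σ q.out)K̃` is injective on `GL_N(K) ⧸ GL_N(𝒪)` — `(δ′Θ_σ y)⁻¹(δ′Θ_σ y′) = Θ_σ(y⁻¹y′) ∈ K̃ ⟹ y⁻¹y′ ∈ K̃` (`qsInvolution_mem_glInt_iff`).
(`τ_{δ′}` is injective on lattices; with `σ ∘ σ = id` it is even an involution up to `Nδ′`, ★ L2 `twistFrame_twistFrame` — not needed here.) [cite: Kottwitz1986BaseChangeUnits, §1 p. 240, §3] -/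
theorem twistFrame_mk_injective (hvσ : ∀ a, Valued.v (σ a) = Valued.v a) (δ' : GL (Fin N) K) :
    Function.Injective fun q : GL (Fin N) K ⧸ glInt N K => ((δ' * UnitaryGroup.qsInvolution σ q.out : GL (Fin N) K) : GL (Fin N) K ⧸ glInt N K) := by
  intro q q' h
  have h' := QuotientGroup.eq.1 h
  have e : (δ' * UnitaryGroup.qsInvolution σ q.out)⁻¹ * (δ' * UnitaryGroup.qsInvolution σ q'.out) = UnitaryGroup.qsInvolution σ (q.out⁻¹ * q'.out) := by
    rw [UnitaryGroup.qsInvolution_mul, qsInvolution_inv]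
    group
  rw [e, qsInvolution_mem_glInt_iff hvσ] at h'
  rw [← QuotientGroup.out_eq' q, ← QuotientGroup.out_eq' q']
  exact QuotientGroup.eq.2 h'

omit [Valued K ℤᵐ⁰] [(Valued.v : Valuation K ℤᵐ⁰).Compatible] in
/-- **CENTRAL SHIFT OF A SHELL**: `ϖ^{k·1}·x ∈ K̃·ϖ^{a + k·1}·K̃ ⟺ x ∈ K̃·ϖ^a·K̃` — `ϖ^{a + k·1} = ϖ^a·ϖ^{k·1}` (★ `zpowDiagGL_add`) and `ϖ^{k·1}` is central (★ `mul_zpowDiagGL_const_comm`), so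
`K̃ϖ^{a+k·1}K̃ = ϖ^{k·1}·K̃ϖ^aK̃`. [cite: Macdonald1995, Ch. V §2 (2.6)] [cite: Rogawski1990, §4.10 (4.10.2) p. 58] -/
theorem zpowDiagGL_const_mul_mem_doubleCoset_add_iff (a : Fin N → ℤ) (k : ℤ) (x : GL (Fin N) K) :
    zpowDiagGL hϖ.ne_zero (fun _ : Fin N => k) * x ∈
        (glInt N K : Set (GL (Fin N) K)) * {zpowDiagGL hϖ.ne_zero (a + fun _ : Fin N => k)} * (glInt N K : Set (GL (Fin N) K)) ↔
      x ∈ (glInt N K : Set (GL (Fin N) K)) * {zpowDiagGL hϖ.ne_zero a} * (glInt N K : Set (GL (Fin N) K)) := by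
  change _ ∈ DoubleCoset.doubleCoset (zpowDiagGL hϖ.ne_zero (a + fun _ : Fin N => k)) (glInt N K : Set (GL (Fin N) K)) (glInt N K) ↔
    x ∈ DoubleCoset.doubleCoset (zpowDiagGL hϖ.ne_zero a) (glInt N K : Set (GL (Fin N) K)) (glInt N K)
  rw [DoubleCoset.mem_doubleCoset, DoubleCoset.mem_doubleCoset, zpowDiagGL_add]
  -- `k₁·(ϖ^a·ϖ^{k·1})·k₂ = ϖ^{k·1}·(k₁·ϖ^a·k₂)` by centrality
  have hc : ∀ k₁ k₂ : GL (Fin N) K, k₁ * (zpowDiagGL hϖ.ne_zero a * zpowDiagGL hϖ.ne_zero (fun _ : Fin N => k)) * k₂ =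
      zpowDiagGL hϖ.ne_zero (fun _ : Fin N => k) * (k₁ * zpowDiagGL hϖ.ne_zero a * k₂) := fun k₁ k₂ => by
    calc k₁ * (zpowDiagGL hϖ.ne_zero a * zpowDiagGL hϖ.ne_zero (fun _ : Fin N => k)) * k₂
        = (k₁ * zpowDiagGL hϖ.ne_zero a) * zpowDiagGL hϖ.ne_zero (fun _ : Fin N => k) * k₂ := by group
      _ = zpowDiagGL hϖ.ne_zero (fun _ : Fin N => k) * (k₁ * zpowDiagGL hϖ.ne_zero a) * k₂ := by rw [mul_zpowDiagGL_const_comm hϖ.ne_zero k]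
      _ = zpowDiagGL hϖ.ne_zero (fun _ : Fin N => k) * (k₁ * zpowDiagGL hϖ.ne_zero a * k₂) := by group
  constructor
  · rintro ⟨k₁, hk₁, k₂, hk₂, e⟩
    refine ⟨k₁, hk₁, k₂, hk₂, mul_left_cancel (a := zpowDiagGL hϖ.ne_zero (fun _ : Fin N => k)) ?_⟩
    rw [e, hc]
  · rintro ⟨k₁, hk₁, k₂, hk₂, rfl⟩
    exact ⟨k₁, hk₁, k₂, hk₂, (hc k₁ k₂).symm⟩

omit [Field K] [Valued K ℤᵐ⁰] [ValuativeRel K] [(Valued.v : Valuation K ℤᵐ⁰).Compatible] hϖ in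
/-- **TWO INJECTIONS ⟹ EQUAL `Set.ncard`**: if `f` maps `s` injectively into `t` and `g` maps `t` injectively into `s`, then `s.ncard = t.ncard` — both finite: the two
inequalities `Set.ncard_le_ncard_of_injOn`; one infinite: so is the other (`Set.infinite_of_injOn_mapsTo`) and both counts are `0`. [folklore] -/
theorem ncard_eq_ncard_of_mapsTo_of_injOn {α β : Type} {s : Set α} {t : Set β} {f : α → β} {g : β → α}
    (hf : Set.MapsTo f s t) (hfi : Set.InjOn f s) (hg : Set.MapsTo g t s) (hgi : Set.InjOn g t) : s.ncard = t.ncard := by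
  by_cases hs : s.Finite
  · by_cases ht : t.Finite
    · exact le_antisymm (Set.ncard_le_ncard_of_injOn f (fun x hx => hf hx) hfi ht) (Set.ncard_le_ncard_of_injOn g (fun y hy => hg hy) hgi hs)
    · exact absurd hs (Set.infinite_of_injOn_mapsTo hgi hg ht)
  · rw [Set.Infinite.ncard hs, Set.Infinite.ncard (Set.infinite_of_injOn_mapsTo hfi hf hs)]

end Tools

/-! ## §2 Exact symmetries of the count `a ↦ #Shell(δ′, a)` — SHEET v2.2 §2 :131 :144 :156 :169 :182 -/

section Symmetries

variable {K : Type} [Field K] [Valued K ℤᵐ⁰] [ValuativeRel K] [(Valued.v : Valuation K ℤᵐ⁰).Compatible] {σ : K →+* K} {N : ℕ}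
  {ϖ : K} (hϖ : IsUniformizingElement ϖ)

/-- **(T4.1) THE COUNT IS A TWISTED-CLASS FUNCTION**: `#Shell(h⁻¹·δ′·Θ_σ(h), a) = #Shell(δ′, a)` for every `h ∈ GL_N(K)` — `q ↦ h • q` is a bijection of the two shells
(`(hg)⁻¹·δ′·Θ_σ(hg) = g⁻¹·(h⁻¹δ′Θ_σ h)·Θ_σ(g)`; the shell condition depends on the coset only since `Θ_σ(K̃) ⊆ K̃` for `σ` isometric, §1 (R) over ★ J2′ `mul_mul_mem_doubleCoset_iff`);
`Set.ncard` along the `Equiv` (Mathlib `MulAction.toPerm h` on `GL_N(K) ⧸ K̃`), no finiteness needed.  Lets a prover put `α_iδ` in `E[γ]^×`-normal form.  (SHEET v2.2 :131, bytes verbatim.)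
[cite: Rogawski1990, §3.11–§3.12; §4.10 p. 56] [cite: Kottwitz1986BaseChangeUnits, §1 p. 240] -/
theorem ncard_twistedShell_twistedConj_eq (hvσ : ∀ a, Valued.v (σ a) = Valued.v a) (h δ' : GL (Fin N) K) (a : Fin N → ℤ) :
    {q : GL (Fin N) K ⧸ glInt N K |
      q.out⁻¹ * (h⁻¹ * δ' * UnitaryGroup.qsInvolution σ h) * UnitaryGroup.qsInvolution σ q.out ∈
        (glInt N K : Set (GL (Fin N) K)) * {zpowDiagGL hϖ.ne_zero a} * (glInt N K : Set (GL (Fin N) K))}.ncard =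
    {q : GL (Fin N) K ⧸ glInt N K |
      q.out⁻¹ * δ' * UnitaryGroup.qsInvolution σ q.out ∈
        (glInt N K : Set (GL (Fin N) K)) * {zpowDiagGL hϖ.ne_zero a} * (glInt N K : Set (GL (Fin N) K))}.ncard := by
  refine Set.ncard_congr' ((MulAction.toPerm h).subtypeEquiv fun q => ?_)
  rw [Set.mem_setOf_eq, Set.mem_setOf_eq, MulAction.toPerm_apply, ← MulAction.Quotient.coe_smul_out, smul_eq_mul,
    mk_out_twistedConj_mem_doubleCoset_iff hvσ δ' (zpowDiagGL hϖ.ne_zero a) (h * q.out)]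
  have e : (h * q.out)⁻¹ * δ' * UnitaryGroup.qsInvolution σ (h * q.out) =
      q.out⁻¹ * (h⁻¹ * δ' * UnitaryGroup.qsInvolution σ h) * UnitaryGroup.qsInvolution σ q.out := by
    rw [UnitaryGroup.qsInvolution_mul, mul_inv_rev]
    group
  rw [e]

/-- **(T4.2) `Λ ↦ τ_{δ′}Λ` MATCHES `Shell(δ′, a)` WITH `Shell(δ′, −w₀a)`**: `#Shell(δ′, a) = #Shell(δ′, (−a_{rev i})_i)` — the frame map `q = gK̃ ↦ (δ′·Θ_σ g)K̃` is well defined on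
cosets (`Θ_σ(K̃) ⊆ K̃`, §1 (R)), INJECTIVE (§1 `twistFrame_mk_injective`), and carries `Shell(δ′, b)` into `Shell(δ′, −w₀b)` for every `b` (§1 `twistFrame_twistedConj_mem_doubleCoset_neg_rev`:
`(δ′Θ_σ g)⁻¹δ′Θ_σ(δ′Θ_σ g) = Θ_σ(g⁻¹δ′Θ_σ g)` and `Θ_σ(K̃ϖ^bK̃) = K̃ϖ^{−w₀b}K̃`); at `b = a` and at `b = −w₀a` (`−w₀(−w₀a) = a`) this gives injections both ways, hence equal
`Set.ncard` (§1 `ncard_eq_ncard_of_mapsTo_of_injOn`; both `0` when infinite).  NO norm hypothesis, no `σ ∘ σ = id`, any `a` (sorted or not).  Lattice words: ★ L2 `relPos_twistFrame`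
`inv(τΛ, τΛ′) = −w₀·inv(Λ, Λ′)` at `Λ′ = τΛ`.  (SHEET v2.2 :144, bytes verbatim.) [cite: Kottwitz1986BaseChangeUnits, §3] [cite: Macdonald1995, Ch. V §2 (2.6)] -/
theorem ncard_twistedShell_eq_ncard_twistedShell_neg_rev (hvσ : ∀ a, Valued.v (σ a) = Valued.v a) (hσϖ : σ ϖ = ϖ) (δ' : GL (Fin N) K) (a : Fin N → ℤ) :
    {q : GL (Fin N) K ⧸ glInt N K |
      q.out⁻¹ * δ' * UnitaryGroup.qsInvolution σ q.out ∈
        (glInt N K : Set (GL (Fin N) K)) * {zpowDiagGL hϖ.ne_zero a} * (glInt N K : Set (GL (Fin N) K))}.ncard =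
    {q : GL (Fin N) K ⧸ glInt N K |
      q.out⁻¹ * δ' * UnitaryGroup.qsInvolution σ q.out ∈
        (glInt N K : Set (GL (Fin N) K)) * {zpowDiagGL hϖ.ne_zero (fun i => - a (Fin.rev i))} * (glInt N K : Set (GL (Fin N) K))}.ncard := by
  -- the frame map `τ` on cosets carries `Shell(δ′, b)` into `Shell(δ′, −w₀b)` for EVERY `b`
  have hmaps : ∀ b : Fin N → ℤ,
      Set.MapsTo (fun q : GL (Fin N) K ⧸ glInt N K => ((δ' * UnitaryGroup.qsInvolution σ q.out : GL (Fin N) K) : GL (Fin N) K ⧸ glInt N K))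
        {q : GL (Fin N) K ⧸ glInt N K |
          q.out⁻¹ * δ' * UnitaryGroup.qsInvolution σ q.out ∈
            (glInt N K : Set (GL (Fin N) K)) * {zpowDiagGL hϖ.ne_zero b} * (glInt N K : Set (GL (Fin N) K))}
        {q : GL (Fin N) K ⧸ glInt N K |
          q.out⁻¹ * δ' * UnitaryGroup.qsInvolution σ q.out ∈
            (glInt N K : Set (GL (Fin N) K)) * {zpowDiagGL hϖ.ne_zero (fun i => - b (Fin.rev i))} * (glInt N K : Set (GL (Fin N) K))} := by
    intro b q hq
    simp only [Set.mem_setOf_eq] at hq ⊢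
    exact (mk_out_twistedConj_mem_doubleCoset_iff hvσ δ' _ (δ' * UnitaryGroup.qsInvolution σ q.out)).2
      (twistFrame_twistedConj_mem_doubleCoset_neg_rev hϖ hvσ hσϖ δ' hq)
  have hinj := twistFrame_mk_injective (σ := σ) hvσ δ'
  refine ncard_eq_ncard_of_mapsTo_of_injOn (hmaps a) hinj.injOn ?_ hinj.injOn
  have h2 := hmaps (fun i => - a (Fin.rev i))
  simp only [Fin.rev_rev, neg_neg] at h2
  exact h2

omit [Valued K ℤᵐ⁰] [(Valued.v : Valuation K ℤᵐ⁰).Compatible] in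
/-- **(T4.3a) CENTRAL SHIFT OF THE BASE POINT**: `Shell(ϖ^{k·1}·δ′, a + (k,…,k)) = Shell(δ′, a)` AS SETS of cosets — `g⁻¹(ϖ^{k·1}δ′)Θ_σ(g) = ϖ^{k·1}·(g⁻¹δ′Θ_σ g)` (★
`mul_zpowDiagGL_const_comm`) and `K̃·ϖ^{a + k·1}·K̃ = ϖ^{k·1}·K̃ϖ^aK̃` (§1 `zpowDiagGL_const_mul_mem_doubleCoset_add_iff`); pointwise in `q` at the SAME representative `q.out`, so no
hypothesis on `σ`.  In the consumer: `ϖ ∈ F^×` is itself a cocycle (`ϖ·Θ_σ(ϖ) = 1`), representing the class `(1,1,1)` of `H¹(F, T) ≅ (ℤ∕2)³` (type (1)); multiplying the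
representative `α_i` by it permutes the classes.  (SHEET v2.2 :156; bytes verbatim, the two unused auto-included
instances `[Valued K ℤᵐ⁰] [Compatible]` omitted — the head is strictly more general.) [cite: Rogawski1990, §4.10 (4.10.2) p. 58] [cite: Macdonald1995, Ch. V §2 (2.6)] -/
theorem twistedShell_zpowDiagGL_const_mul_eq (δ' : GL (Fin N) K) (a : Fin N → ℤ) (k : ℤ) :
    {q : GL (Fin N) K ⧸ glInt N K |
      q.out⁻¹ * (zpowDiagGL hϖ.ne_zero (fun _ : Fin N => k) * δ') * UnitaryGroup.qsInvolution σ q.out ∈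
        (glInt N K : Set (GL (Fin N) K)) * {zpowDiagGL hϖ.ne_zero (a + fun _ : Fin N => k)} * (glInt N K : Set (GL (Fin N) K))} =
    {q : GL (Fin N) K ⧸ glInt N K |
      q.out⁻¹ * δ' * UnitaryGroup.qsInvolution σ q.out ∈
        (glInt N K : Set (GL (Fin N) K)) * {zpowDiagGL hϖ.ne_zero a} * (glInt N K : Set (GL (Fin N) K))} := by
  ext q
  have e : q.out⁻¹ * (zpowDiagGL hϖ.ne_zero (fun _ : Fin N => k) * δ') * UnitaryGroup.qsInvolution σ q.out =
      zpowDiagGL hϖ.ne_zero (fun _ : Fin N => k) * (q.out⁻¹ * δ' * UnitaryGroup.qsInvolution σ q.out) := by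
    calc q.out⁻¹ * (zpowDiagGL hϖ.ne_zero (fun _ : Fin N => k) * δ') * UnitaryGroup.qsInvolution σ q.out
        = (q.out⁻¹ * zpowDiagGL hϖ.ne_zero (fun _ : Fin N => k)) * δ' * UnitaryGroup.qsInvolution σ q.out := by group
      _ = (zpowDiagGL hϖ.ne_zero (fun _ : Fin N => k) * q.out⁻¹) * δ' * UnitaryGroup.qsInvolution σ q.out := by
          rw [mul_zpowDiagGL_const_comm hϖ.ne_zero k]
      _ = zpowDiagGL hϖ.ne_zero (fun _ : Fin N => k) * (q.out⁻¹ * δ' * UnitaryGroup.qsInvolution σ q.out) := by group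
  rw [Set.mem_setOf_eq, Set.mem_setOf_eq, e, zpowDiagGL_const_mul_mem_doubleCoset_add_iff hϖ a k]

/-- **(T4.3b) HOMOTHETY OF THE LATTICE**: `Λ ↦ ϖΛ` matches `Shell(δ′, a)` with `Shell(δ′, a − (2,…,2))` — `(gϖ)⁻¹δ′Θ_σ(gϖ) = ϖ⁻²·(g⁻¹δ′Θ_σ g)` for `σ ϖ = ϖ` (★ L1
`qsInvolution_zpowDiagGL` at the constant vector).  So `#Shell(δ′, a) = #Shell(δ′, a − 2·1)`: the count is `2ℤ·(1,…,1)`-periodic in `a` (distinct lattices, same number).  Proof =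
(T4.1) at `h = ϖ^{−1·1}` (`(ϖ^{−1·1})⁻¹·δ′·Θ_σ(ϖ^{−1·1}) = ϖ^{1·1}·δ′·ϖ^{1·1} = ϖ^{2·1}·δ′`) followed by (T4.3a) at `k = 2` (`Shell(ϖ^{2·1}δ′, (a − 2·1) + 2·1) = Shell(δ′, a − 2·1)`).
BINDER NOTE (census (Q-3b), typ2 SPEC «=» 03:48:56Z): `hvσ` (`σ` valuation-preserving) is load-bearing — without it the `q.out`-tested shell depends on the choice of coset
representatives (§1 (R) needs `Θ_σ(K̃) ⊆ K̃`) and the identity is not derivable for Mathlib's unspecified `Quotient.out`.  (SHEET v2.2 :169, bytes verbatim.)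
[cite: Kottwitz1986BaseChangeUnits, §3] [cite: Rogawski1990, §4.10 (4.10.2) p. 58] -/
theorem ncard_twistedShell_eq_ncard_twistedShell_sub_two (hvσ : ∀ a, Valued.v (σ a) = Valued.v a) (hσϖ : σ ϖ = ϖ)
    (δ' : GL (Fin N) K) (a : Fin N → ℤ) :
    {q : GL (Fin N) K ⧸ glInt N K |
      q.out⁻¹ * δ' * UnitaryGroup.qsInvolution σ q.out ∈
        (glInt N K : Set (GL (Fin N) K)) * {zpowDiagGL hϖ.ne_zero a} * (glInt N K : Set (GL (Fin N) K))}.ncard =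
    {q : GL (Fin N) K ⧸ glInt N K |
      q.out⁻¹ * δ' * UnitaryGroup.qsInvolution σ q.out ∈
        (glInt N K : Set (GL (Fin N) K)) * {zpowDiagGL hϖ.ne_zero (a - fun _ : Fin N => 2)} * (glInt N K : Set (GL (Fin N) K))}.ncard := by
  -- (T4.1) at `h = ϖ^{−1·1}`
  have h1 := ncard_twistedShell_twistedConj_eq hϖ hvσ (zpowDiagGL hϖ.ne_zero fun _ : Fin N => (-1 : ℤ)) δ' a
  have hconj : (zpowDiagGL hϖ.ne_zero fun _ : Fin N => (-1 : ℤ))⁻¹ * δ' * UnitaryGroup.qsInvolution σ (zpowDiagGL hϖ.ne_zero fun _ : Fin N => (-1 : ℤ)) =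
      zpowDiagGL hϖ.ne_zero (fun _ : Fin N => (2 : ℤ)) * δ' := by
    have e1 : (zpowDiagGL hϖ.ne_zero fun _ : Fin N => (-1 : ℤ))⁻¹ = zpowDiagGL hϖ.ne_zero (fun _ : Fin N => (1 : ℤ)) := by
      rw [← zpowDiagGL_neg]
      congr 1
    have e2 : UnitaryGroup.qsInvolution σ (zpowDiagGL hϖ.ne_zero fun _ : Fin N => (-1 : ℤ)) = zpowDiagGL hϖ.ne_zero (fun _ : Fin N => (1 : ℤ)) := by
      rw [qsInvolution_zpowDiagGL hϖ.ne_zero hσϖ]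
      congr 1
    have e3 : (zpowDiagGL hϖ.ne_zero (fun _ : Fin N => (1 : ℤ)) * zpowDiagGL hϖ.ne_zero (fun _ : Fin N => (1 : ℤ)) : GL (Fin N) K) =
        zpowDiagGL hϖ.ne_zero (fun _ : Fin N => (2 : ℤ)) := by
      rw [← zpowDiagGL_add]
      congr 1
    rw [e1, e2, mul_assoc, mul_zpowDiagGL_const_comm hϖ.ne_zero 1 δ', ← mul_assoc, e3]
  rw [hconj] at h1
  -- (T4.3a) at `k = 2`, base point `δ′`, exponent `a − 2·1`
  rw [← h1, ← twistedShell_zpowDiagGL_const_mul_eq hϖ δ' (a - fun _ : Fin N => (2 : ℤ)) 2, sub_add_cancel]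

/-- **(T4.3c) p08's «FREE CONSISTENCY RUNG» AS A COUNT IDENTITY (`N = 3`)**: `#Shell(δ′, (1,1,0)) = #Shell(ϖ·δ′, (1,0,0))` — (T4.2): `(1,1,0) ↦ −w₀(1,1,0) = (0,−1,−1)`, then
(T4.3a) with `k = 1`: `Shell(ϖ^{1·1}δ′, (0,−1,−1) + (1,1,1)) = Shell(δ′, (0,−1,−1))`.  Read over the classes `α_iδ`: the second Hecke shell of the class of `α_i` is the first shell
of the class of `ϖα_i` («the surviving classes at the two shells have opposite det-parity», K8-CENSUS §3), so the first LAYER of E1.4.4.2.2 is ONE count.  (SHEET v2.2 :182, bytes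
verbatim.) [cite: Rogawski1990, §4.10 (4.10.2) p. 58] [cite: Kottwitz1986BaseChangeUnits, §3] -/
theorem ncard_twistedShell_one_one_zero_eq (hvσ : ∀ a, Valued.v (σ a) = Valued.v a) (hσϖ : σ ϖ = ϖ) (δ' : GL (Fin 3) K) :
    {q : GL (Fin 3) K ⧸ glInt 3 K |
      q.out⁻¹ * δ' * UnitaryGroup.qsInvolution σ q.out ∈
        (glInt 3 K : Set (GL (Fin 3) K)) * {zpowDiagGL hϖ.ne_zero ![1, 1, 0]} * (glInt 3 K : Set (GL (Fin 3) K))}.ncard =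
    {q : GL (Fin 3) K ⧸ glInt 3 K |
      q.out⁻¹ * (zpowDiagGL hϖ.ne_zero (fun _ : Fin 3 => (1 : ℤ)) * δ') * UnitaryGroup.qsInvolution σ q.out ∈
        (glInt 3 K : Set (GL (Fin 3) K)) * {zpowDiagGL hϖ.ne_zero ![1, 0, 0]} * (glInt 3 K : Set (GL (Fin 3) K))}.ncard := by
  rw [ncard_twistedShell_eq_ncard_twistedShell_neg_rev hϖ hvσ hσϖ δ' ![1, 1, 0]]
  have e1 : (fun i : Fin 3 => -((![1, 1, 0] : Fin 3 → ℤ) (Fin.rev i))) = ![0, -1, -1] := by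
    funext i
    fin_cases i <;> rfl
  have e2 : (![1, 0, 0] : Fin 3 → ℤ) = ![0, -1, -1] + fun _ : Fin 3 => (1 : ℤ) := by
    funext i
    fin_cases i <;> rfl
  rw [e1, e2, twistedShell_zpowDiagGL_const_mul_eq hϖ δ' ![0, -1, -1] 1]

end Symmetries

end Summit.HodgeConjecture.HodgeConjecture.R90.S6

end
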